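import Mathlib
import Summits.CriticalPhenomena.CardyFormulaZ2.Theorems.CardySelfRefinementDefs
import Summits.CriticalPhenomena.CardyFormulaZ2.Theorems.CardySelfRefinementRussoDriftPolynomial
import Literature.Probability.Percolation.PivotalCell
import HarnessLib

/-!
# Locality of the six-arm sector term (line `far-field-is-a-quarter-turn`, crux `TrivialSectorRate`,
stmt-CriticalPhenomena-10266), helper of stub `stub_sixArmSectorMass`

The six-arm SECTOR term of a block, `Six k m F η q u R = M_k(q)(six arms from ring k+1 to R around
k•u ∧ Rel u R)`, carries the factor `Rel u R` = "the lattice `R`-box about the block centre `k•u` is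
set-pivotal (`IsPivotalOn`) for the localised joint crossing event `Aloc m F η`".  `Aloc` reads only
the finite `window m F η` (the nearest-neighbour edges drawn through the `1`-thickening of some
carrier `[F i]`), so a box whose edges miss the window is never relevant.  This file proves:

* `Six_le_real_sixArmThreeClustersAt`, `Six_le_real_Rel`, `Six_le_one` — the trivial bounds
  `Six u R ≤ M_k(q)(sixArmThreeClustersAt (k•u) (k+1) R)`, `Six u R ≤ M_k(q)(Rel u R)`, `Six ≤ 1`;
* `determinedBy_Aloc_window` — `Aloc` is determined by the window;
  `determinedBy_setOf_isPivotalOn_compl` — set-pivotality on `C` is determined by the coordinates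
  OFF `C`; `not_isPivotalOn_of_determinedBy_of_disjoint` — a set of coordinates disjoint from a
  determining set is never pivotal;
* `Rel_eq_empty_of_disjoint_window` / `Six_eq_zero_of_disjoint_window` — **`Rel u R = ∅` and
  `Six u R = 0` as soon as `boxEdgesAt (k•u) R` is disjoint from the window**;
* `dist_z_le_of_sub_mem_box` — a site of the lattice `R`-box about `c` is drawn within
  `2√2 |η| R` of the drawn centre; whence the metric criterion
  `disjoint_boxEdgesAt_window_of_le_infDist`: if the drawn block centre `η·z(k•u)` lies at distance
  `≥ 1 + 2√2|η|(R+1)` from every carrier `[F i]`, the `R`-box misses the window, and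
  **`Six_eq_zero_of_le_infDist`** (registered helper): then `Six k m F η q u R = 0` — the six-arm
  sector terms of the (infinitely many) far blocks away from the quads vanish identically.
-/

noncomputable section

namespace Summit.CriticalPhenomena.CardyFormulaZ2.Theorems.CardySelfRefinement.FarField

open scoped Topology
open Filter Set MeasureTheory
open Literature.Probability.LatticeModels Literature.Probability.Percolation
open Literature.Probability.Percolation.QuadCrossing
open Summit.CriticalPhenomena.CardyFormulaZ2.Theses.CardySelfRefinement

/-! ## Trivial bounds on the sector term -/

/-- `Six u R ≤ M_k(q)(six arms from the ring k+1 to R around k•u)` (drop the relevance factor). -/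
theorem Six_le_real_sixArmThreeClustersAt (k m : ℕ) (F : Fin m → Quad (univ : Set ℂ)) (η : ℝ)
    (q : ℝ × ℝ) (u : Site 2) (R : ℕ) :
    Six k m F η q u R ≤ (M k q.1 q.2).real (sixArmThreeClustersAt (ctr k u) (k + 1) R) := by
  haveI := isProbabilityMeasure_M k q.1 q.2
  exact measureReal_mono Set.inter_subset_left (measure_ne_top _ _)

/-- `Six u R ≤ M_k(q)(Rel u R)` (drop the six-arm factor). -/
theorem Six_le_real_Rel (k m : ℕ) (F : Fin m → Quad (univ : Set ℂ)) (η : ℝ) (q : ℝ × ℝ)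
    (u : Site 2) (R : ℕ) : Six k m F η q u R ≤ (M k q.1 q.2).real (Rel k m F η u R) := by
  haveI := isProbabilityMeasure_M k q.1 q.2
  exact measureReal_mono Set.inter_subset_right (measure_ne_top _ _)

/-- `Six u R ≤ 1` (a probability). -/
theorem Six_le_one (k m : ℕ) (F : Fin m → Quad (univ : Set ℂ)) (η : ℝ) (q : ℝ × ℝ) (u : Site 2)
    (R : ℕ) : Six k m F η q u R ≤ 1 := by
  haveI := isProbabilityMeasure_M k q.1 q.2
  exact measureReal_le_one

/-- `0 ≤ Six u R`. -/
theorem Six_nonneg' (k m : ℕ) (F : Fin m → Quad (univ : Set ℂ)) (η : ℝ) (q : ℝ × ℝ) (u : Site 2)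
    (R : ℕ) : 0 ≤ Six k m F η q u R := measureReal_nonneg

/-! ## Locality: relevance needs the window -/

/-- `Aloc m F η = {ω | ω ∩ window ∈ A}` is determined by the window. -/
theorem determinedBy_Aloc_window (m : ℕ) (F : Fin m → Quad (univ : Set ℂ)) (η : ℝ) :
    DeterminedBy (Aloc m F η) (window m F η) := by
  rw [determinedBy_iff]
  intro ω ω' h
  simp only [Aloc, Set.mem_setOf_eq, h]

/-- **Set-pivotality on `C` is decided off `C`**: `{ω | IsPivotalOn A C ω}` is determined by `Cᶜ`
(the fibre `{ω' | ω' = ω off C}` is the same for two configurations agreeing off `C`, and `C` is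
pivotal iff `A` is not constant on that fibre). -/
theorem determinedBy_setOf_isPivotalOn_compl {ι : Type*} (A : Set (Set ι)) (C : Set ι) :
    DeterminedBy {ω | IsPivotalOn A C ω} Cᶜ := by
  rw [determinedBy_iff]
  -- one direction suffices, by symmetry
  suffices key : ∀ ω₁ ω₂ : Set ι, ω₁ ∩ Cᶜ = ω₂ ∩ Cᶜ → IsPivotalOn A C ω₁ → IsPivotalOn A C ω₂ from
    fun ω₁ ω₂ h => ⟨key ω₁ ω₂ h, key ω₂ ω₁ h.symm⟩
  rintro ω₁ ω₂ h ⟨ω', hagree, hflip⟩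
  have h12 : ∀ i, i ∉ C → (i ∈ ω₁ ↔ i ∈ ω₂) := fun i hi =>
    ⟨fun h1 => ((Set.ext_iff.1 h i).1 ⟨h1, hi⟩).1, fun h2 => ((Set.ext_iff.1 h i).2 ⟨h2, hi⟩).1⟩
  by_cases hA : (ω₂ ∈ A ↔ ω₁ ∈ A)
  · -- the witness of `ω₁` works for `ω₂`
    exact ⟨ω', fun i hi => (hagree i hi).trans (h12 i hi), fun hiff => hflip (hiff.trans hA)⟩
  · -- `ω₁` itself is a witness for `ω₂`
    exact ⟨ω₁, fun i hi => h12 i hi, fun hiff => hA hiff.symm⟩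

/-- A set of coordinates disjoint from a determining set of `A` is never pivotal for `A`. -/
theorem not_isPivotalOn_of_determinedBy_of_disjoint {ι : Type*} {A : Set (Set ι)} {W C : Set ι}
    (hA : DeterminedBy A W) (hCW : Disjoint C W) (ω : Set ι) : ¬ IsPivotalOn A C ω := by
  rintro ⟨ω', hagree, hflip⟩
  refine hflip ((determinedBy_iff A W).1 hA ω' ω (Set.ext fun i => ?_))
  simp only [Set.mem_inter_iff]
  constructor
  · rintro ⟨hi', hiW⟩
    exact ⟨(hagree i (Set.disjoint_right.1 hCW hiW)).1 hi', hiW⟩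
  · rintro ⟨hi, hiW⟩
    exact ⟨(hagree i (Set.disjoint_right.1 hCW hiW)).2 hi, hiW⟩

/-- **A box missing the window is irrelevant**: if `boxEdgesAt (k•u) R` is disjoint from
`window m F η` then `Rel k m F η u R = ∅`. -/
theorem Rel_eq_empty_of_disjoint_window (k m : ℕ) (F : Fin m → Quad (univ : Set ℂ)) (η : ℝ)
    (u : Site 2) (R : ℕ) (h : Disjoint (boxEdgesAt (ctr k u) R) (window m F η)) :
    Rel k m F η u R = ∅ :=
  Set.eq_empty_of_forall_notMem fun ω hω =>
    not_isPivotalOn_of_determinedBy_of_disjoint (determinedBy_Aloc_window m F η) h ω hω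

/-- … and then the six-arm sector term vanishes: `Six k m F η q u R = 0`. -/
theorem Six_eq_zero_of_disjoint_window (k m : ℕ) (F : Fin m → Quad (univ : Set ℂ)) (η : ℝ)
    (q : ℝ × ℝ) (u : Site 2) (R : ℕ) (h : Disjoint (boxEdgesAt (ctr k u) R) (window m F η)) :
    Six k m F η q u R = 0 := by
  unfold Six
  rw [Rel_eq_empty_of_disjoint_window k m F η u R h, Set.inter_empty, measureReal_empty]

/-! ## The metric criterion -/

/-- A site of the lattice `R`-box about `c` is drawn, at mesh `η`, within `2√2 |η| R` of the drawn
centre (`z = √2 · (x₀ + i x₁)`, `ℓ¹ ≤ 2 ℓ^∞`). -/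
theorem dist_z_le_of_sub_mem_box {v c : Site 2} {R : ℕ} (hv : v - c ∈ box 2 R) (η : ℝ) :
    dist ((η : ℂ) * squareLatticeEmbedding.z v) ((η : ℂ) * squareLatticeEmbedding.z c) ≤
      2 * Real.sqrt 2 * |η| * R := by
  rw [dist_eq_norm, ← mul_sub, norm_mul, Complex.norm_real, Real.norm_eq_abs]
  have hz : squareLatticeEmbedding.z v - squareLatticeEmbedding.z c =
      ((Real.sqrt 2 : ℝ) : ℂ) * (Site.toComplex v - Site.toComplex c) := by
    show ((Real.sqrt 2 : ℝ) : ℂ) * Site.toComplex v - ((Real.sqrt 2 : ℝ) : ℂ) * Site.toComplex c = _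
    ring
  rw [hz, norm_mul, Complex.norm_real, Real.norm_of_nonneg (Real.sqrt_nonneg _)]
  rw [mem_box] at hv
  have h0 := hv 0
  have h1 := hv 1
  simp only [Pi.sub_apply] at h0 h1
  have hre : (Site.toComplex v - Site.toComplex c).re = (v 0 : ℝ) - c 0 := by simp [Site.toComplex]
  have him : (Site.toComplex v - Site.toComplex c).im = (v 1 : ℝ) - c 1 := by simp [Site.toComplex]
  have h0' : |(v 0 : ℝ) - c 0| ≤ R := by
    rw [abs_le]
    constructor
    · have : ((-(R : ℤ) : ℤ) : ℝ) ≤ ((v 0 - c 0 : ℤ) : ℝ) := by exact_mod_cast h0.1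
      push_cast at this; linarith
    · have : ((v 0 - c 0 : ℤ) : ℝ) ≤ ((R : ℤ) : ℝ) := by exact_mod_cast h0.2
      push_cast at this; linarith
  have h1' : |(v 1 : ℝ) - c 1| ≤ R := by
    rw [abs_le]
    constructor
    · have : ((-(R : ℤ) : ℤ) : ℝ) ≤ ((v 1 - c 1 : ℤ) : ℝ) := by exact_mod_cast h1.1
      push_cast at this; linarith
    · have : ((v 1 - c 1 : ℤ) : ℝ) ≤ ((R : ℤ) : ℝ) := by exact_mod_cast h1.2
      push_cast at this; linarith
  have hn : ‖Site.toComplex v - Site.toComplex c‖ ≤ 2 * R :=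
    calc ‖Site.toComplex v - Site.toComplex c‖
        ≤ |(Site.toComplex v - Site.toComplex c).re| + |(Site.toComplex v - Site.toComplex c).im| :=
          Complex.norm_le_abs_re_add_abs_im _
      _ ≤ R + R := by rw [hre, him]; exact add_le_add h0' h1'
      _ = 2 * R := by ring
  have hη := abs_nonneg η
  have hs := Real.sqrt_nonneg 2
  calc |η| * (Real.sqrt 2 * ‖Site.toComplex v - Site.toComplex c‖)
      ≤ |η| * (Real.sqrt 2 * (2 * R)) := by gcongr
    _ = 2 * Real.sqrt 2 * |η| * R := by ring

/-- **Metric criterion**: if the drawn block centre `η·z(k•u)` lies at distance at least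
`1 + 2√2|η|(R+1)` from every carrier `[F i]`, then the lattice `R`-box about `k•u` is disjoint from
the window (every window edge is drawn through the `1`-thickening of some carrier, and every edge of
the box is drawn within `2√2|η|(R+1)` of the drawn centre). -/
theorem disjoint_boxEdgesAt_window_of_le_infDist (k m : ℕ) (F : Fin m → Quad (univ : Set ℂ))
    (η : ℝ) (u : Site 2) (R : ℕ)
    (h : ∀ i, 1 + 2 * Real.sqrt 2 * |η| * (R + 1) ≤
      Metric.infDist ((η : ℂ) * squareLatticeEmbedding.z (ctr k u)) (F i).carrier) :
    Disjoint (boxEdgesAt (ctr k u) R) (window m F η) := by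
  rw [Set.disjoint_left]
  rintro e ⟨he, hbox⟩ hwin
  obtain ⟨i, hi⟩ := Set.mem_iUnion.1 hwin
  obtain ⟨⟨x, y, rfl, w, hwseg, hwth⟩, -⟩ := hi
  have hadj : (zdGraph 2).Adj x y := (SimpleGraph.mem_edgeSet _).1 he
  have hx : x - ctr k u ∈ box 2 R := hbox x (Sym2.mem_mk_left x y)
  -- `w` is close to the drawn centre
  have hwx : dist w ((η : ℂ) * squareLatticeEmbedding.z x) ≤ 2 * Real.sqrt 2 * |η| := by
    have h1 := segment_subset_closedBall_left
      ((η : ℂ) * squareLatticeEmbedding.z x) ((η : ℂ) * squareLatticeEmbedding.z y) hwseg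
    rw [Metric.mem_closedBall] at h1
    exact h1.trans (dist_z_le_of_adj hadj η)
  have hxc := dist_z_le_of_sub_mem_box hx η
  have hwc : dist w ((η : ℂ) * squareLatticeEmbedding.z (ctr k u)) ≤ 2 * Real.sqrt 2 * |η| * (R + 1) :=
    calc dist w ((η : ℂ) * squareLatticeEmbedding.z (ctr k u))
        ≤ dist w ((η : ℂ) * squareLatticeEmbedding.z x) +
            dist ((η : ℂ) * squareLatticeEmbedding.z x) ((η : ℂ) * squareLatticeEmbedding.z (ctr k u)) :=
          dist_triangle _ _ _
      _ ≤ 2 * Real.sqrt 2 * |η| + 2 * Real.sqrt 2 * |η| * R := add_le_add hwx hxc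
      _ = 2 * Real.sqrt 2 * |η| * (R + 1) := by ring
  -- `w` lies within distance `1` of a point of `[F i]`
  obtain ⟨p, hp, hwp⟩ := Metric.mem_thickening_iff.1 hwth
  -- contradiction with the triangle inequality for `infDist`
  have h1 : Metric.infDist ((η : ℂ) * squareLatticeEmbedding.z (ctr k u)) (F i).carrier ≤
      dist ((η : ℂ) * squareLatticeEmbedding.z (ctr k u)) p := Metric.infDist_le_dist_of_mem hp
  have h2 : dist ((η : ℂ) * squareLatticeEmbedding.z (ctr k u)) p ≤
      dist ((η : ℂ) * squareLatticeEmbedding.z (ctr k u)) w + dist w p := dist_triangle _ _ _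
  rw [dist_comm _ w] at h2
  have := h i
  linarith

/-- **FAR BLOCKS AWAY FROM THE QUADS CARRY NO SIX-ARM SECTOR TERM** (registered helper of
`stub_sixArmSectorMass`).  If the drawn block centre `η·z(k•u)` lies at distance
`≥ 1 + 2√2|η|(R+1)` from every carrier `[F i]`, then `Six k m F η q u R = 0`: the lattice `R`-box
about `k•u` misses the window of `Aloc`, so it is never relevant (`Rel u R = ∅`). -/
theorem Six_eq_zero_of_le_infDist (k m : ℕ) (F : Fin m → Quad (univ : Set ℂ)) (η : ℝ) (q : ℝ × ℝ)
    (u : Site 2) (R : ℕ)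
    (h : ∀ i, 1 + 2 * Real.sqrt 2 * |η| * (R + 1) ≤
      Metric.infDist ((η : ℂ) * squareLatticeEmbedding.z (ctr k u)) (F i).carrier) :
    Six k m F η q u R = 0 :=
  Six_eq_zero_of_disjoint_window k m F η q u R (disjoint_boxEdgesAt_window_of_le_infDist k m F η u R h)

/-- The relevance version: under the same metric hypothesis `Rel k m F η u R = ∅`. -/
theorem Rel_eq_empty_of_le_infDist (k m : ℕ) (F : Fin m → Quad (univ : Set ℂ)) (η : ℝ)
    (u : Site 2) (R : ℕ)
    (h : ∀ i, 1 + 2 * Real.sqrt 2 * |η| * (R + 1) ≤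
      Metric.infDist ((η : ℂ) * squareLatticeEmbedding.z (ctr k u)) (F i).carrier) :
    Rel k m F η u R = ∅ :=
  Rel_eq_empty_of_disjoint_window k m F η u R (disjoint_boxEdgesAt_window_of_le_infDist k m F η u R h)

end Summit.CriticalPhenomena.CardyFormulaZ2.Theorems.CardySelfRefinement.FarField

end
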